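import Summits.ValiantsHypothesis.ValiantsHypothesis.Theorems.DepthWindowHomRel
import Mathlib.Data.List.GetD
import Mathlib.Algebra.BigOperators.Group.Finset.Piecewise

/-!
# DepthWindow — the kernel base rung `HomRel 0 0` of the block-lemma family

`HomRel k j` (see `Theorems/DepthWindowHomRel.lean`) is the relative homogenisation block lemma
behind the crux `HomSubReach` of route `route-ValiantsHypothesis-DepthWindow`.  This module proves
its bottom member in the kernel:

* `homRel_zero_zero : HomRel 0 0` — a block of relative product-depth `0` consists of SUM gates
  only, so every gate value is an affine form `C c + ∑ a_t X_t`; its `w`-weighted homogeneous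
  component of weighted degree `e` is `C c · [e = 0] + ∑_{w t = e} a_t X_t`, computed by ONE sum gate
  over the variables of weight `e` (and the constant `1` when `e = 0`).  The witness list has
  `|Φ|·(d+1)` gates, all of product-depth `0`, all weighted-homogeneous — exponent `a = 2`.
* `homRel_zero : ∀ j, HomRel 0 j` (by `HomRel.le_right`).

Purpose (critic g5/g6, decomposition workshop): certify that the TYPING of the family is
satisfiable and non-junk at its base (the operands `out i e` really are forced to evaluate to the
weighted components of every gate of the block, the `RefsBelow`, depth and length clauses are
jointly consistent), so that the open members `HomRel 2 2`, `HomRel 3 4`, `HomRel 5 7` carry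
content.  Everything is proved from the tree's circuit semantics (`gateValues`, `gateWDepths`);
no named facts.

[cite: LimayeSrinivasanTavenas2025, Lemma 19, Lemma 20] [cite: Burgisser2000, Def. 2.1]
-/

-- layout Summits/ValiantsHypothesis/ValiantsHypothesis forces the duplicated namespace component
set_option linter.dupNamespace false

noncomputable section

namespace Summit.ValiantsHypothesis.ValiantsHypothesis.Theorems.DepthWindow

open MvPolynomial Literature.Computability.AlgebraicComplexity ArithCircuit

variable {τ : Type} (w : τ → ℕ)

/-! ### Two fold lemmas for gate lists whose gates ignore the earlier values -/

/-- If every gate of `Ψ` evaluates to `v g` against ANY value list, the value list of `Ψ` is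
`Ψ.map v` (Bürgisser 2000, Def. 2.1: left fold). [cite: Burgisser2000, Def. 2.1] -/
theorem gateValues_eq_map_of_forall {Ψ : List (Gate ℂ τ)} {v : Gate ℂ τ → MvPolynomial τ ℂ}
    (h : ∀ g ∈ Ψ, ∀ vals, g.eval vals = v g) : gateValues Ψ = Ψ.map v := by
  induction Ψ using List.reverseRecOn with
  | nil => simp [gateValues]
  | append_singleton gs g ih =>
    rw [gateValues_append_singleton, List.map_append, List.map_singleton,
      ih (fun g' hg' => h g' (List.mem_append_left _ hg')), h g (by simp)]

/-- If every gate of `Ψ` has weight-plus-operand-depth `0` against ANY depth list, the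
`prodWeight`-depth list of `Ψ` is all zeros (LST 2021 §2: left fold). [cite: LST2021, §2] -/
theorem gateWDepths_eq_replicate_of_forall {Ψ : List (Gate ℂ τ)}
    (h : ∀ g ∈ Ψ, ∀ ds : List ℕ,
      prodWeight g + ((g.args.map (Operand.depthIn ds)).foldr max 0) = 0) :
    gateWDepths prodWeight Ψ = List.replicate Ψ.length 0 := by
  induction Ψ using List.reverseRecOn with
  | nil => simp [gateWDepths]
  | append_singleton gs g ih =>
    rw [gateWDepths_append_singleton, ih (fun g' hg' => h g' (List.mem_append_left _ hg')),
      h g (by simp), List.length_append, List.length_singleton, List.replicate_succ']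

/-- A `foldr max 0` over a list of zeros is `0`. [cite: LST2021, §2] -/
theorem foldr_max_eq_zero {l : List ℕ} (h : ∀ x ∈ l, x = 0) : l.foldr max 0 = 0 := by
  induction l with
  | nil => rfl
  | cons a l ih =>
    rw [List.foldr_cons, h a (by simp), ih (fun x hx => h x (by simp [hx]))]
    rfl

section Gadget

variable [Fintype τ]

/-! ### The product-depth-`0` gadget: one sum gate per weighted component of an affine form -/

/-- The value of the gadget: the weight-`e` part `C (coeff 0 p)·[e = 0] + ∑_{w t = e} coeff_{X t}(p) • X t`
of the affine part of `p`. [cite: LimayeSrinivasanTavenas2025, Lemma 19] -/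
def affVal (e : ℕ) (p : MvPolynomial τ ℂ) : MvPolynomial τ ℂ :=
  (if e = 0 then C (coeff 0 p) else 0) +
    ∑ t ∈ Finset.univ.filter (fun t => w t = e), coeff (Finsupp.single t 1) p • X t

/-- The gadget itself: ONE sum gate over the variables of weight `e` (and the constant `1` when
`e = 0`), with the coefficients of the affine part of `p`; it references no gate.
[cite: LimayeSrinivasanTavenas2025, Lemma 19] [cite: Burgisser2000, Def. 2.1] -/
def affGate (e : ℕ) (p : MvPolynomial τ ℂ) : Gate ℂ τ :=
  .sum ((if e = 0 then [(coeff 0 p, Operand.const 1)] else []) ++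
    ((Finset.univ.filter (fun t => w t = e)).toList.map
      fun t => (coeff (Finsupp.single t 1) p, Operand.var t)))

/-- The gadget evaluates to `affVal` against any value list. [cite: Burgisser2000, Def. 2.1] -/
theorem eval_affGate (e : ℕ) (p : MvPolynomial τ ℂ) (vals : List (MvPolynomial τ ℂ)) :
    (affGate w e p).eval vals = affVal w e p := by
  unfold affGate affVal
  by_cases he : e = 0
  · simp only [he, if_true, Gate.eval, List.map_append, List.map_cons, List.map_nil,
      List.sum_append, List.sum_cons, List.sum_nil, add_zero, List.map_map, Function.comp_def,
      Operand.eval, Finset.sum_map_toList, smul_eq_C_mul, C_1, mul_one]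
  · simp only [he, if_false, Gate.eval, List.map_append, List.map_nil, List.sum_append,
      List.sum_nil, zero_add, List.map_map, Function.comp_def, Operand.eval,
      Finset.sum_map_toList]

/-- The gadget is a sum gate. [cite: LST2021, §2] -/
theorem prodWeight_affGate (e : ℕ) (p : MvPolynomial τ ℂ) : prodWeight (affGate w e p) = 0 := by
  simp [prodWeight, affGate, Gate.isProd]

/-- Every operand of the gadget is a variable or a constant, hence of depth `0`.
[cite: LST2021, §2] -/
theorem depthIn_of_mem_args_affGate {e : ℕ} {p : MvPolynomial τ ℂ} {ds : List ℕ}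
    {u : Operand ℂ τ} (hu : u ∈ (affGate w e p).args) : Operand.depthIn ds u = 0 := by
  unfold affGate at hu
  by_cases he : e = 0
  · simp only [he, if_true, Gate.args, List.map_append, List.map_cons, List.map_nil,
      List.mem_append, List.mem_singleton, List.map_map, List.mem_map, Function.comp_def,
      Finset.mem_toList] at hu
    rcases hu with rfl | ⟨t, _, rfl⟩ <;> rfl
  · simp only [he, if_false, Gate.args, List.nil_append,
      List.map_map, List.mem_map, Function.comp_def, Finset.mem_toList] at hu
    obtain ⟨t, _, rfl⟩ := hu
    rfl

/-- The gadget has `prodWeight`-depth `0` against any depth list. [cite: LST2021, §2] -/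
theorem wdepth_affGate (e : ℕ) (p : MvPolynomial τ ℂ) (ds : List ℕ) :
    prodWeight (affGate w e p) + (((affGate w e p).args.map (Operand.depthIn ds)).foldr max 0)
      = 0 := by
  rw [prodWeight_affGate, zero_add]
  apply foldr_max_eq_zero
  intro x hx
  rw [List.mem_map] at hx
  obtain ⟨u, hu, rfl⟩ := hx
  exact depthIn_of_mem_args_affGate w hu

/-- The gadget value is `w`-weighted homogeneous of weighted degree `e`.
[cite: LimayeSrinivasanTavenas2025, Lemma 19] -/
theorem isWeightedHomogeneous_affVal (e : ℕ) (p : MvPolynomial τ ℂ) :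
    IsWeightedHomogeneous w (affVal w e p) e := by
  unfold affVal
  refine IsWeightedHomogeneous.add ?_ ?_
  · by_cases he : e = 0
    · rw [if_pos he, he]
      exact isWeightedHomogeneous_C w _
    · rw [if_neg he]
      exact isWeightedHomogeneous_zero ℂ w e
  · refine IsWeightedHomogeneous.sum _ _ _ fun t ht => ?_
    rw [Finset.mem_filter] at ht
    rw [smul_eq_C_mul, ← ht.2]
    exact (isWeightedHomogeneous_X ℂ w t).C_mul _

/-! ### `affVal w e` is linear and agrees with the weighted component on affine forms -/

/-- Additivity of the gadget value. [cite: LimayeSrinivasanTavenas2025, Lemma 19] -/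
theorem affVal_add (e : ℕ) (p q : MvPolynomial τ ℂ) :
    affVal w e (p + q) = affVal w e p + affVal w e q := by
  unfold affVal
  simp only [coeff_add, C_add, add_smul, Finset.sum_add_distrib]
  split_ifs <;> abel

/-- Homogeneity (scalars) of the gadget value. [cite: LimayeSrinivasanTavenas2025, Lemma 19] -/
theorem affVal_smul (e : ℕ) (c : ℂ) (p : MvPolynomial τ ℂ) :
    affVal w e (c • p) = c • affVal w e p := by
  unfold affVal
  simp only [coeff_smul, smul_eq_mul, smul_add, Finset.smul_sum, smul_smul]
  congr 1
  split_ifs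
  · rw [C_mul, smul_eq_C_mul]
  · rw [smul_zero]

/-- The gadget value of `0` is `0`. [cite: LimayeSrinivasanTavenas2025, Lemma 19] -/
theorem affVal_zero (e : ℕ) : affVal w e (0 : MvPolynomial τ ℂ) = 0 := by
  simp [affVal]

/-- On the constant `1` the gadget value is the weighted component.
[cite: LimayeSrinivasanTavenas2025, Lemma 19] -/
theorem affVal_one (e : ℕ) :
    affVal w e (1 : MvPolynomial τ ℂ) = weightedHomogeneousComponent w e 1 := by
  classical
  rw [weightedHomogeneousComponent_of_mem
    ((mem_weightedHomogeneousSubmodule _ _ _ _).mpr (isWeightedHomogeneous_one ℂ w))]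
  have h1 : ∀ t : τ, coeff (Finsupp.single t 1) (1 : MvPolynomial τ ℂ) = 0 := fun t => by
    rw [coeff_one, if_neg]
    exact (Finsupp.single_ne_zero.mpr one_ne_zero).symm
  unfold affVal
  simp only [coeff_zero_one, C_1, h1, zero_smul, Finset.sum_const_zero, add_zero]

/-- On a variable the gadget value is the weighted component.
[cite: LimayeSrinivasanTavenas2025, Lemma 19] -/
theorem affVal_X (e : ℕ) (t₀ : τ) :
    affVal w e (X t₀ : MvPolynomial τ ℂ) = weightedHomogeneousComponent w e (X t₀) := by
  classical
  rw [weightedHomogeneousComponent_of_mem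
    ((mem_weightedHomogeneousSubmodule _ _ _ _).mpr (isWeightedHomogeneous_X ℂ w t₀))]
  unfold affVal
  rw [coeff_zero_X, C_0, ite_self, zero_add]
  simp only [coeff_X, Finsupp.single_left_inj (one_ne_zero), ite_smul, one_smul, zero_smul,
    Finset.sum_ite_eq, Finset.mem_filter, Finset.mem_univ, true_and]
  by_cases h : w t₀ = e
  · rw [if_pos h, if_pos h.symm]
  · rw [if_neg h, if_neg (Ne.symm h)]

/-- On a constant the gadget value is the weighted component.
[cite: LimayeSrinivasanTavenas2025, Lemma 19] -/
theorem affVal_C (e : ℕ) (c : ℂ) :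
    affVal w e (C c : MvPolynomial τ ℂ) = weightedHomogeneousComponent w e (C c) := by
  rw [C_eq_smul_one, affVal_smul, map_smul, affVal_one]

/-- Closure under list sums of "the gadget computes every weighted component".
[cite: LimayeSrinivasanTavenas2025, Lemma 19] -/
theorem affVal_list_sum {l : List (MvPolynomial τ ℂ)}
    (h : ∀ x ∈ l, ∀ e, affVal w e x = weightedHomogeneousComponent w e x) :
    ∀ e, affVal w e l.sum = weightedHomogeneousComponent w e l.sum := by
  induction l with
  | nil => intro e; simp [affVal_zero]
  | cons a l ih =>
    intro e
    rw [List.sum_cons, affVal_add, map_add, h a (by simp) e,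
      ih (fun x hx => h x (by simp [hx])) e]

/-- **Blocks of relative product-depth `0` are affine**: if every gate of `Φ` has
`prodWeight`-depth `≤ 0`, every gate is a sum gate and the gadget computes every weighted
component of every gate value. [cite: LimayeSrinivasanTavenas2025, Lemma 19]
[cite: Burgisser2000, Def. 2.1] -/
theorem affVal_gateValues_of_depth_zero (Φ : List (Gate ℂ τ))
    (hΦ : ∀ n ∈ gateWDepths prodWeight Φ, n ≤ 0) :
    ∀ v ∈ gateValues Φ, ∀ e, affVal w e v = weightedHomogeneousComponent w e v := by
  induction Φ using List.reverseRecOn with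
  | nil => intro v hv; simp [gateValues] at hv
  | append_singleton gs g ih =>
    rw [gateWDepths_append_singleton] at hΦ
    have hgs : ∀ n ∈ gateWDepths prodWeight gs, n ≤ 0 := fun n hn =>
      hΦ n (List.mem_append_left _ hn)
    have hg := hΦ _ (List.mem_append_right _ (List.mem_singleton_self _))
    intro v hv
    rw [gateValues_append_singleton, List.mem_append, List.mem_singleton] at hv
    rcases hv with hv | rfl
    · exact ih hgs v hv
    · cases g with
      | prod args =>
        exfalso
        simp [prodWeight, Gate.isProd] at hg
      | sum args =>
        simp only [Gate.eval]
        apply affVal_list_sum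
        intro x hx
        rw [List.mem_map] at hx
        obtain ⟨⟨c, u⟩, _, rfl⟩ := hx
        intro e
        rw [affVal_smul, map_smul]
        congr 1
        cases u with
        | var t => exact affVal_X w e t
        | const c' => exact affVal_C w e c'
        | gate j =>
          simp only [Operand.eval]
          by_cases hj : j < (gateValues gs).length
          · rw [List.getD_eq_getElem _ _ hj]
            exact ih hgs _ (List.getElem_mem hj) e
          · rw [List.getD_eq_default _ _ (not_lt.mp hj), affVal_zero, map_zero]

/-! ### The witness list for `HomRel 0 0` -/

/-- The witness gate list: gate number `e + i·(d+1)` is the gadget for the weight-`e` component of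
gate `i` of `Φ`. [cite: LimayeSrinivasanTavenas2025, Lemma 19] -/
def zeroPsi (d : ℕ) (Φ : List (Gate ℂ τ)) : List (Gate ℂ τ) :=
  (List.range (Φ.length * (d + 1))).map fun n =>
    affGate w (n % (d + 1)) ((gateValues Φ).getD (n / (d + 1)) 0)

/-- Length of the witness list. [cite: LimayeSrinivasanTavenas2025, Lemma 19] -/
theorem length_zeroPsi (d : ℕ) (Φ : List (Gate ℂ τ)) :
    (zeroPsi w d Φ).length = Φ.length * (d + 1) := by
  simp [zeroPsi]

/-- Values of the witness list. [cite: Burgisser2000, Def. 2.1] -/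
theorem gateValues_zeroPsi (d : ℕ) (Φ : List (Gate ℂ τ)) :
    gateValues (zeroPsi w d Φ) = (List.range (Φ.length * (d + 1))).map fun n =>
      affVal w (n % (d + 1)) ((gateValues Φ).getD (n / (d + 1)) 0) := by
  rw [gateValues_eq_map_of_forall (v := fun g => g.eval [])]
  · rw [zeroPsi, List.map_map]
    apply List.map_congr_left
    intro n _
    simp only [Function.comp_apply, eval_affGate]
  · intro g hg vals
    rw [zeroPsi, List.mem_map] at hg
    obtain ⟨n, -, rfl⟩ := hg
    rw [eval_affGate, eval_affGate]

/-- Depths of the witness list: all `0`. [cite: LST2021, §2] -/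
theorem gateWDepths_zeroPsi (d : ℕ) (Φ : List (Gate ℂ τ)) :
    gateWDepths prodWeight (zeroPsi w d Φ) = List.replicate (Φ.length * (d + 1)) 0 := by
  rw [gateWDepths_eq_replicate_of_forall, length_zeroPsi]
  intro g hg ds
  rw [zeroPsi, List.mem_map] at hg
  obtain ⟨n, -, rfl⟩ := hg
  exact wdepth_affGate w _ _ ds

end Gadget

/-- **`HomRel 0 0`** — the base rung of the block-lemma family, in the kernel (exponent `a = 2`).
[cite: LimayeSrinivasanTavenas2025, Lemma 19, Lemma 20] [cite: Burgisser2000, Def. 2.1] -/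
theorem homRel_zero_zero : HomRel 0 0 := by
  refine ⟨2, ?_⟩
  intro τ _ w _hw d Φ hΦ
  refine ⟨zeroPsi w d Φ, fun i e => Operand.gate (e + i * (d + 1)), ?_, ?_, ?_, ?_⟩
  · -- every gate value is weighted homogeneous
    intro g hg
    rw [gateValues_zeroPsi, List.mem_map] at hg
    obtain ⟨n, -, rfl⟩ := hg
    exact ⟨n % (d + 1), isWeightedHomogeneous_affVal w _ _⟩
  · -- product-depth 0
    intro n hn
    rw [gateWDepths_zeroPsi] at hn
    exact (List.eq_of_mem_replicate hn).le
  · -- length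
    rw [length_zeroPsi]
    calc Φ.length * (d + 1)
        ≤ (Φ.length + Fintype.card τ + d + 2) * (Φ.length + Fintype.card τ + d + 2) :=
          Nat.mul_le_mul (by omega) (by omega)
      _ = (Φ.length + Fintype.card τ + d + 2) ^ 2 := (pow_two _).symm
      _ ≤ (Φ.length + Fintype.card τ + d + 2) ^ 2 * 2 ^ (2 * d * d) :=
          Nat.le_mul_of_pos_right _ (Nat.two_pow_pos _)
  · -- the outputs
    intro i e hi he
    have hed : e < d + 1 := Nat.lt_succ_of_le he
    have hidx : e + i * (d + 1) < Φ.length * (d + 1) :=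
      calc e + i * (d + 1) < (d + 1) + i * (d + 1) := by omega
        _ = (i + 1) * (d + 1) := by ring
        _ ≤ Φ.length * (d + 1) := Nat.mul_le_mul_right _ hi
    have hdiv : (e + i * (d + 1)) / (d + 1) = i := by
      rw [Nat.add_mul_div_right _ _ (Nat.succ_pos d), Nat.div_eq_of_lt hed, zero_add]
    have hmod : (e + i * (d + 1)) % (d + 1) = e := by
      rw [Nat.add_mul_mod_self_right, Nat.mod_eq_of_lt hed]
    refine ⟨?_, ?_⟩
    · show e + i * (d + 1) < (zeroPsi w d Φ).length
      rwa [length_zeroPsi]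
    · rw [Operand.eval_gate, gateValues_zeroPsi,
        List.getD_eq_getElem _ _ (by simpa using hidx), List.getElem_map, List.getElem_range,
        hdiv, hmod]
      have hi' : i < (gateValues Φ).length := by rwa [gateValues_length]
      have hmem : (gateValues Φ).getD i 0 ∈ gateValues Φ := by
        rw [List.getD_eq_getElem _ _ hi']
        exact List.getElem_mem hi'
      exact affVal_gateValues_of_depth_zero w Φ hΦ _ hmem e

/-- Every `HomRel 0 j` holds. [cite: LimayeSrinivasanTavenas2025, Lemma 19] -/
theorem homRel_zero (j : ℕ) : HomRel 0 j :=
  homRel_zero_zero.le_right (Nat.zero_le j)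

end Summit.ValiantsHypothesis.ValiantsHypothesis.Theorems.DepthWindow

end
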